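import Summits.ResolutionOfSingularities.ResolutionOfSingularities.Theorems.RadicialJungCleanModelsCcurvePersistForm2Alg
import Summits.ResolutionOfSingularities.ResolutionOfSingularities.Theorems.RadicialJungCleanModelsCcurvePointPrepWeak
import Summits.ResolutionOfSingularities.ResolutionOfSingularities.Theorems.RadicialJungCleanModelsCcurveResiduePerfect
import Summits.ResolutionOfSingularities.ResolutionOfSingularities.Theorems.RadicialJungCleanModelsCcurvePDegreeRepLoc
import Summits.ResolutionOfSingularities.ResolutionOfSingularities.Theorems.RadicialJungCleanModelsCleanLU3CompositeCdiv
import Summits.ResolutionOfSingularities.ResolutionOfSingularities.Theorems.RadicialJungCleanModelsCleanLU3CompositeFormOneLift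
import Literature.AlgebraicGeometry.Resolution.EmbeddedResolutionExcellentSurfaces
import Summits.ResolutionOfSingularities.ResolutionOfSingularities.Theorems.RadicialJungCleanModelsCcurveRebaseField
import HarnessLib

/-!
# Route `RadicialJung`, crux `CleanModels` (stmt-15917) — (C-curve) sub-line: `stub_Cc_persistForm2` modulo the shared stub `stub_Cc_centreCurve` only

Lead `res-B-lead-1` g6 (plan `Cruxes/CleanModels/Lines/Sketch-memo-Ccurve-plan.md` §1 S5a; workfile `Lines/Sketch_Ccurve_assembly.lean` v2.4 stub
`Ccurve.stub_Cc_persistForm2`).  OURS · counted 0.  Nothing here proves resolution in characteristic `p`; resolution in char `p` is NOT proved.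

`persistForm2_of`: the statement of `stub_Cc_persistForm2` (closed-point persist, UNIT CASE: the `K^p`-line of `g₀` has a representative which is a unit of
`locAtCentre B O₁` with residue not a `p`-th power in `κ(C)`) from ONE hypothesis stated as a closed proposition:
(hS3) the shared stub `stub_Cc_centreCurve` VERBATIM (F-32 = ✓ `CossartJannsenSaito2020Embedded` on the centre curve; porter 2).  The other inputs are landed:
✓ `Ccurve.residue_perfect_locAtCentre` (perfect residue fields at the closed centre over perfect `k`), ✓ `Ccurve.pdegree_rep_locAtCentre` (the `p`-degree-`p`
representation `d^p w ≡ Σ w_j^p z^j (mod (x, y))`, Matsumura 26.5 + 5.6 via ✓ `finrank_frobenius_residueField_eq_pow`), ✓ `Ccurve.pointPrep_weak` (the part of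
the shared stub `stub_Cc_pointPrep` this step needs) and ✓ `Ccurve.exists_sub_pow_eq_of_form2` (the algebra in `O_{X,P}` and the DVR `O_{C,P}`).
Route: S3 ⇒ `C` regular, r.s.p. `(x, y, z)`, `locAtCentre · O₁` unchanged; the unit `u = a/b` (`a, b ∈ B′`) is replaced by `w = b^p u ∈ locAtCentre B′ O`
(`K^p`-rescaling `c ↦ c b`); form (2) gives `hw` of ✓ `exists_sub_pow_eq_of_form2` ⇒ `w − c^p = U z^i + x α + y β`, `p ∤ i`; S5₀ with `n = i + 1` ⇒
`w − c^p = z^i (U + z (x′ α + y′ β))` = unit `· z^i` at `locAtCentre B″ O` with r.s.p. `(z, x′, y′)`: FORM (1), `m = 1`.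
-/

noncomputable section

set_option linter.dupNamespace false

open IsLocalRing Literature.AlgebraicGeometry.Resolution
open Summit.ResolutionOfSingularities.ResolutionOfSingularities.Theorems
open Summit.ResolutionOfSingularities.ResolutionOfSingularities.Theorems.SwitchingDichotomy

namespace Summit.ResolutionOfSingularities.ResolutionOfSingularities.Theorems.RadicialJung.CleanModels.Ccurve

/-- **`stub_Cc_persistForm2` modulo the shared stub `stub_Cc_centreCurve` (S3)** — see the module docstring. [folklore] -/
theorem persistForm2_of
    (hS3 :
    ∀ (k : Type) [Field k] (K : Type) [Field K] [Algebra k K]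
    (O : ValuationSubring K) (A : Subalgebra k K), A.toSubring ≤ O.toSubring → A.FG → IsFractionRing A K → ringKrullDim A ≤ 3 →
    (∀ (T : Subring K) (hT : T ≤ O.toSubring), A.toSubring ≤ T → (subringCentre T O hT).IsMaximal) →
    ∀ (B : Subalgebra k K) (hBO : B.toSubring ≤ O.toSubring), A ≤ B → B.FG →
    IsRegularLocalRing (locAtCentre B.toSubring O) → ringKrullDim (locAtCentre B.toSubring O) = 3 →
    ∀ (O₁ : ValuationSubring K), O ≤ O₁ → ringKrullDim (locAtCentre B.toSubring O₁) = 2 →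
    ∃ (B' : Subalgebra k K) (hB'O : B'.toSubring ≤ O.toSubring), B ≤ B' ∧ B'.FG ∧
    IsRegularLocalRing (locAtCentre B'.toSubring O) ∧ ringKrullDim (locAtCentre B'.toSubring O) = 3 ∧
    locAtCentre B'.toSubring O₁ = locAtCentre B.toSubring O₁ ∧
    ∃ (x y z : K) (hx : x ∈ locAtCentre B'.toSubring O) (hy : y ∈ locAtCentre B'.toSubring O) (hz : z ∈ locAtCentre B'.toSubring O),
      (haveI := isLocalRing_locAtCentre hB'O; IsLocalRing.maximalIdeal (locAtCentre B'.toSubring O)) =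
        Ideal.span {⟨x, hx⟩, ⟨y, hy⟩, ⟨z, hz⟩} ∧
      ∀ w : ↥(locAtCentre B'.toSubring O), O₁.valuation (w : K) < 1 ↔ w ∈ Ideal.span {(⟨x, hx⟩ : ↥(locAtCentre B'.toSubring O)), ⟨y, hy⟩} )
:
    ∀ (p : ℕ), p.Prime →
    ∀ (k : Type) [Field k] [CharP k p] [PerfectField k] (K : Type) [Field K] [Algebra k K]
    (O : ValuationSubring K) (A : Subalgebra k K), A.toSubring ≤ O.toSubring → A.FG → IsFractionRing A K →
    ringKrullDim A ≤ 3 → IsRegularLocalRing (locAtCentre A.toSubring O) →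
    ringKrullDim (locAtCentre A.toSubring O) = 3 →
    (∀ (T : Subring K) (hT : T ≤ O.toSubring), A.toSubring ≤ T → (subringCentre T O hT).IsMaximal) →
    ∀ g₀ : K, (∀ c : K, c ^ p ≠ g₀) →
    ¬ (∃ (O₁ : ValuationSubring K), O ≤ O₁ ∧ O₁ ≠ ⊤ ∧ ∃ y : Fin 2 → K, (∀ i, y i ∈ O) ∧
      ∀ P : MvPolynomial (Fin 2) k, P ≠ 0 → O₁.valuation (MvPolynomial.aeval y P) = 1) →
    ∀ (O₁ : ValuationSubring K), O ≤ O₁ → O₁ ≠ O → O₁ ≠ ⊤ →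
    ∀ (B : Subalgebra k K), B.toSubring ≤ O.toSubring → A ≤ B → B.FG →
    IsRegularLocalRing (locAtCentre B.toSubring O) → ringKrullDim (locAtCentre B.toSubring O) = 3 →
    ringKrullDim ↥(locAtCentre B.toSubring O₁) = 2 →
    ∀ (_ : IsRegularLocalRing ↥(locAtCentre B.toSubring O₁)) (c : Fin p → K), (∃ j : Fin p, (j : ℕ) ≠ 0 ∧ c j ≠ 0) →
    (∃ u : ↥(locAtCentre B.toSubring O₁), IsUnit u ∧ (∑ j : Fin p, c j ^ p * g₀ ^ (j : ℕ)) = (u : K) ∧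
    ∀ c' : ↥(locAtCentre B.toSubring O₁), u - c' ^ p ∉ IsLocalRing.maximalIdeal ↥(locAtCentre B.toSubring O₁)) →
    ∃ (A' : Subalgebra k K), A'.toSubring ≤ O.toSubring ∧ A ≤ A' ∧ A'.FG ∧
    ∃ (_ : IsRegularLocalRing ↥(locAtCentre A'.toSubring O)) (c : Fin p → K), (∃ j : Fin p, (j : ℕ) ≠ 0 ∧ c j ≠ 0) ∧
    ((∃ (d m : ℕ) (hmd : m ≤ d) (t : Fin d → ↥(locAtCentre A'.toSubring O)) (a : Fin m → ℕ) (u : ↥(locAtCentre A'.toSubring O)), IsUnit u ∧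
    Ideal.span (Set.range t) = IsLocalRing.maximalIdeal ↥(locAtCentre A'.toSubring O) ∧
    ringKrullDim ↥(locAtCentre A'.toSubring O) = (d : WithBot ℕ∞) ∧ 0 < m ∧ (∀ i, ¬ p ∣ a i) ∧
    (∑ j : Fin p, c j ^ p * g₀ ^ (j : ℕ)) = (u : K) * ∏ i : Fin m, ((t (Fin.castLE hmd i) : ↥(locAtCentre A'.toSubring O)) : K) ^ (a i)) ∨
    (∃ u : ↥(locAtCentre A'.toSubring O), IsUnit u ∧ (∑ j : Fin p, c j ^ p * g₀ ^ (j : ℕ)) = (u : K) ∧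
    ∀ c' : ↥(locAtCentre A'.toSubring O), u - c' ^ p ∉ IsLocalRing.maximalIdeal ↥(locAtCentre A'.toSubring O)) ∨
    (∃ s c' : ↥(locAtCentre A'.toSubring O), (∑ j : Fin p, c j ^ p * g₀ ^ (j : ℕ)) = (s : K) ∧
    s - c' ^ p ∈ IsLocalRing.maximalIdeal ↥(locAtCentre A'.toSubring O) ∧
    s - c' ^ p ∉ IsLocalRing.maximalIdeal ↥(locAtCentre A'.toSubring O) ^ 2))  := by
  intro p hp k _ _ _ K _ _ O A hAO hAfg hfrac hdimA hreg hdim3 hzd g₀ hg₀ hdiv O₁ hOO₁ hne hO₁ B hBO hAB hBfg hBreg hBdim hBdim₁ hreg₁ c hc h2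
  classical
  haveI : Fact p.Prime := ⟨hp⟩
  haveI := hfrac
  have hBO₁ : B.toSubring ≤ O₁.toSubring := fun w hw => hOO₁ (hBO hw)
  obtain ⟨u, hu, hGu, hres⟩ := h2
  -- S3: the centre curve made regular
  obtain ⟨B', hB'O, hBB', hB'fg, hB'reg, hB'dim, hloc₁, x, y, z, hx, hy, hz, hmax, hcen⟩ :=
    hS3 k K O A hAO hAfg hfrac hdimA hzd B hBO hAB hBfg hBreg hBdim O₁ hOO₁ hBdim₁
  haveI := isLocalRing_locAtCentre hB'O
  haveI : IsRegularLocalRing ↥(locAtCentre B'.toSubring O) := hB'reg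
  have hB'O₁ : B'.toSubring ≤ O₁.toSubring := fun w hw => hOO₁ (hB'O hw)
  have hS'S₁ : locAtCentre B'.toSubring O ≤ locAtCentre B'.toSubring O₁ := by
    rintro v ⟨y₁, hy₁, z₁, hz₁, hvz₁, rfl⟩
    exact ⟨y₁, hy₁, z₁, hz₁, Shannon.valuation_eq_one_of_le hOO₁ hvz₁, rfl⟩
  -- the unit `u = a / b`
  have huS₁ : (u : K) ∈ locAtCentre B'.toSubring O₁ := by rw [hloc₁]; exact u.2
  obtain ⟨a, haB', b, hbB', hvb, hab⟩ := mem_locAtCentre_iff.mp huS₁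
  have hb0 : b ≠ 0 := ne_zero_of_valuation_eq_one hvb
  have hu1 : O₁.valuation (u : K) = 1 := by
    obtain ⟨hu0, huinv⟩ := (isUnit_subring_iff_inv_mem u).mp hu
    have h1 : O₁.valuation (u : K) ≤ 1 := (O₁.valuation_le_one_iff _).mpr (locAtCentre_le hBO₁ u.2)
    have h2 : O₁.valuation (u : K)⁻¹ ≤ 1 := (O₁.valuation_le_one_iff _).mpr (locAtCentre_le hBO₁ huinv)
    rw [map_inv₀, inv_le_one₀ (zero_lt_iff.mpr ((Valuation.ne_zero_iff _).mpr hu0))] at h2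
    exact le_antisymm h1 h2
  -- `w = b^p u = a b^(p-1) ∈ B'`
  set w : K := b ^ p * (u : K) with hwdef
  have hw_eq : w = a * b ^ (p - 1) := by
    obtain ⟨q, hq⟩ : ∃ q, p = q + 1 := ⟨p - 1, (Nat.sub_add_cancel hp.one_lt.le).symm⟩
    rw [hwdef, hab, hq, Nat.add_sub_cancel, pow_succ]; field_simp
  have hwB' : w ∈ B' := by rw [hw_eq]; exact B'.mul_mem haB' (B'.pow_mem hbB' _)
  have hwS' : w ∈ locAtCentre B'.toSubring O := le_locAtCentre _ _ hwB'
  have hvw : O₁.valuation w = 1 := by rw [hwdef, map_mul, map_pow, hvb, one_pow, one_mul, hu1]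
  -- abbreviations in the local ring `S' = locAtCentre B' O`
  set x' : ↥(locAtCentre B'.toSubring O) := ⟨x, hx⟩ with hx'
  set y' : ↥(locAtCentre B'.toSubring O) := ⟨y, hy⟩ with hy'
  set z' : ↥(locAtCentre B'.toSubring O) := ⟨z, hz⟩ with hz'
  set w' : ↥(locAtCentre B'.toSubring O) := ⟨w, hwS'⟩ with hw'
  -- `hw`: `w` is not a `p`-th power modulo `(x, y)` after clearing denominators off the curve
  have hw : ∀ a₁ b₁ : ↥(locAtCentre B'.toSubring O), b₁ ∉ Ideal.span ({x', y'} : Set _) →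
      b₁ ^ p * w' - a₁ ^ p ∉ Ideal.span ({x', y'} : Set _) := by
    intro a₁ b₁ hb₁ hmem
    have hvb₁ : O₁.valuation (b₁ : K) = 1 := by
      have h1 : ¬ O₁.valuation (b₁ : K) < 1 := fun h => hb₁ ((hcen b₁).mp h)
      exact le_antisymm ((O₁.valuation_le_one_iff _).mpr (hOO₁ (locAtCentre_le hB'O b₁.2))) (not_lt.mp h1)
    have hlt : O₁.valuation ((b₁ : K) ^ p * w - (a₁ : K) ^ p) < 1 := (hcen _).mpr hmem
    -- the competitor `c'' = a₁ / (b₁ b)` in `locAtCentre B O₁`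
    have hb₁0 : (b₁ : K) ≠ 0 := ne_zero_of_valuation_eq_one hvb₁
    have hinv : ((b₁ : K) * b)⁻¹ ∈ locAtCentre B'.toSubring O₁ := by
      obtain ⟨y₂, hy₂, z₂, hz₂, hvz₂, hb₁eq⟩ := mem_locAtCentre_iff.mp (hS'S₁ b₁.2)
      have hvy₂ : O₁.valuation y₂ = 1 := by
        have : (b₁ : K) * z₂ = y₂ := by rw [hb₁eq]; field_simp [ne_zero_of_valuation_eq_one hvz₂]
        rw [← this, map_mul, hvb₁, hvz₂, one_mul]
      refine ⟨z₂, hz₂, y₂ * b, B'.toSubring.mul_mem hy₂ hbB', by rw [map_mul, hvy₂, hvb, one_mul], ?_⟩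
      rw [hb₁eq]; field_simp [ne_zero_of_valuation_eq_one hvz₂, ne_zero_of_valuation_eq_one hvy₂]
    have hc'' : (a₁ : K) * ((b₁ : K) * b)⁻¹ ∈ locAtCentre B.toSubring O₁ := by
      rw [← hloc₁]; exact Subring.mul_mem _ (hS'S₁ a₁.2) hinv
    apply hres ⟨_, hc''⟩
    rw [mem_maximalIdeal_locAtCentre_iff hBO₁]
    have hne : ((b₁ : K) * b) ^ p ≠ 0 := pow_ne_zero _ (mul_ne_zero hb₁0 hb0)
    have hcalc : (u : K) - ((a₁ : K) * ((b₁ : K) * b)⁻¹) ^ p = ((b₁ : K) ^ p * w - (a₁ : K) ^ p) / ((b₁ : K) * b) ^ p := by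
      rw [eq_div_iff hne, sub_mul, mul_pow (a₁ : K) (((b₁ : K) * b)⁻¹) p, inv_pow, inv_mul_cancel_right₀ hne, hwdef]; ring
    change O₁.valuation ((u : K) - ((a₁ : K) * ((b₁ : K) * b)⁻¹) ^ p) < 1
    rw [hcalc, map_div₀, map_pow, map_mul, hvb₁, hvb, one_mul, one_pow, div_one]
    exact hlt
  -- the algebraic step at `S'`
  haveI : CharP ↥(locAtCentre B'.toSubring O) p := by
    have hinj : Function.Injective ((algebraMap k K).codRestrict (locAtCentre B'.toSubring O)
      (fun c₀ => le_locAtCentre _ _ (B'.algebraMap_mem c₀))) := fun a₁ a₂ h =>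
        (algebraMap k K).injective (congrArg Subtype.val h)
    exact charP_of_injective_ringHom hinj p
  have hd : (maximalIdeal ↥(locAtCentre B'.toSubring O)).spanFinrank = 3 := spanFinrank_eq_three_of_dim _ hB'dim
  have hxyz : Ideal.span ({x', y', z'} : Set _) = maximalIdeal ↥(locAtCentre B'.toSubring O) := hmax.symm
  have hperfS := residue_perfect_locAtCentre k K p O A hAO hAfg hzd B' hB'O (hAB.trans hBB') hB'fg
  have hrepS := pdegree_rep_locAtCentre k K p O A hAO hAfg hzd O₁ hOO₁ B' hB'O (hAB.trans hBB') hB'fg hB'reg hB'dim (by rw [hloc₁]; exact hBdim₁)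
    x y z hx hy hz hmax hcen
  obtain ⟨cc, U, α, β, i, hU, hi, hrel⟩ :=
    exists_sub_pow_eq_of_form2 p hd x' y' z' hxyz hperfS hrepS w' hw
  -- S5₀: `n = i + 1` point blow-ups
  obtain ⟨B'', hB''O, hAB'', hB''fg, hB''reg, hB''dim, hSS, h₁, h₂, h₃, hmax''⟩ :=
    pointPrep_weak k K O A hAO hAfg hfrac hdimA hzd B' hB'O (hAB.trans hBB') hB'fg hB'reg hB'dim O₁ hOO₁ x y z hx hy hz hmax hcen (i + 1)
  haveI := isLocalRing_locAtCentre hB''O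
  haveI : IsRegularLocalRing ↥(locAtCentre B''.toSubring O) := hB''reg
  have hz0 : z ≠ 0 := by
    intro h0
    have hzm : z' ∈ Ideal.span ({x', y'} : Set _) := by
      rw [show z' = 0 from Subtype.ext h0]; exact Ideal.zero_mem _
    exact not_mem_span_pair_of_rsp hd x' y' z' hmax hzm
  -- the unit upstairs
  have hUval : O.valuation (U : K) = 1 := by
    obtain ⟨hU0, hUinv⟩ := (isUnit_subring_iff_inv_mem U).mp hU
    have h1 : O.valuation (U : K) ≤ 1 := (O.valuation_le_one_iff _).mpr (locAtCentre_le hB'O U.2)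
    have h2 : O.valuation (U : K)⁻¹ ≤ 1 := (O.valuation_le_one_iff _).mpr (locAtCentre_le hB'O hUinv)
    rw [map_inv₀, inv_le_one₀ (zero_lt_iff.mpr ((Valuation.ne_zero_iff _).mpr hU0))] at h2
    exact le_antisymm h1 h2
  set U₂ : K := (U : K) + z * (x / z ^ (i + 1) * (α : K) + y / z ^ (i + 1) * (β : K)) with hU₂
  have hU₂mem : U₂ ∈ locAtCentre B''.toSubring O :=
    Subring.add_mem _ (hSS U.2) (Subring.mul_mem _ h₃ (Subring.add_mem _ (Subring.mul_mem _ h₁ (hSS α.2)) (Subring.mul_mem _ h₂ (hSS β.2))))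
  have hU₂unit : IsUnit (⟨U₂, hU₂mem⟩ : ↥(locAtCentre B''.toSubring O)) := by
    rw [isUnit_subring_iff_inv_mem]
    have hvz : O.valuation z < 1 := by
      have : z' ∈ maximalIdeal ↥(locAtCentre B'.toSubring O) := by rw [hmax]; exact Ideal.subset_span (by simp)
      exact (mem_maximalIdeal_locAtCentre_iff hB'O _).mp this
    have hvm : O.valuation (z * (x / z ^ (i + 1) * (α : K) + y / z ^ (i + 1) * (β : K))) < 1 := by
      rw [map_mul]
      calc O.valuation z * O.valuation (x / z ^ (i + 1) * (α : K) + y / z ^ (i + 1) * (β : K))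
          ≤ O.valuation z * 1 := by
            gcongr
            exact (O.valuation_le_one_iff _).mpr (locAtCentre_le hB''O
              (Subring.add_mem _ (Subring.mul_mem _ h₁ (hSS α.2)) (Subring.mul_mem _ h₂ (hSS β.2))))
        _ < 1 := by rw [mul_one]; exact hvz
    have hvU₂ : O.valuation U₂ = 1 := by
      rw [hU₂, Valuation.map_add_eq_of_lt_left _ (by rw [hUval]; exact hvm), hUval]
    have hU₂0 : U₂ ≠ 0 := ne_zero_of_valuation_eq_one hvU₂
    refine ⟨hU₂0, ?_⟩
    exact inv_mem_locAtCentre hU₂mem hvU₂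
  -- the identity `w - cc^p = U₂ z^i`
  have hrelK : w - (cc : K) ^ p = (U : K) * z ^ i + x * (α : K) + y * (β : K) := by
    have := congrArg Subtype.val hrel
    simpa using this
  have hkey : w - (cc : K) ^ p = U₂ * z ^ i := by
    rw [hrelK, hU₂]; field_simp; ring
  -- the new representative
  let c' : Fin p → K := fun j => if (j : ℕ) = 0 then c j * b - (cc : K) else c j * b
  have hsum : (∑ j : Fin p, c' j ^ p * g₀ ^ (j : ℕ)) = w - (cc : K) ^ p := by
    have h0 : (⟨0, hp.pos⟩ : Fin p) ∈ (Finset.univ : Finset (Fin p)) := Finset.mem_univ _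
    have hG : (∑ j : Fin p, c j ^ p * g₀ ^ (j : ℕ)) = (u : K) := hGu
    have hwsum : w = ∑ j : Fin p, (c j * b) ^ p * g₀ ^ (j : ℕ) := by
      rw [hwdef, ← hG, Finset.mul_sum]
      refine Finset.sum_congr rfl fun j _ => ?_
      rw [mul_pow]; ring
    rw [hwsum, ← Finset.add_sum_erase _ _ h0, ← Finset.add_sum_erase _ _ h0]
    have hrest : ∑ j ∈ Finset.univ.erase (⟨0, hp.pos⟩ : Fin p), c' j ^ p * g₀ ^ (j : ℕ) =
        ∑ j ∈ Finset.univ.erase (⟨0, hp.pos⟩ : Fin p), (c j * b) ^ p * g₀ ^ (j : ℕ) := by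
      refine Finset.sum_congr rfl fun j hj => ?_
      have hj0 : (j : ℕ) ≠ 0 := fun h => (Finset.ne_of_mem_erase hj) (Fin.ext h)
      simp only [c', if_neg hj0]
    rw [hrest]
    simp only [c', if_true, pow_zero, mul_one]
    haveI : CharP K p := charP_of_injective_algebraMap (algebraMap k K).injective p
    rw [sub_pow_char (p := p) (c ⟨0, hp.pos⟩ * b) (cc : K)]
    ring
  -- packaging: form (1) at `locAtCentre B'' O` with `t = (z, x/z^n, y/z^n)`, `a = (i)`
  refine ⟨B'', hB''O, hAB'', hB''fg, hB''reg, c', ?_, Or.inl ?_⟩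
  · obtain ⟨j₀, hj₀, hcj₀⟩ := hc
    refine ⟨j₀, hj₀, ?_⟩
    simp only [c', if_neg hj₀]
    exact mul_ne_zero hcj₀ hb0
  refine ⟨3, 1, by norm_num, ![⟨z, h₃⟩, ⟨x / z ^ (i + 1), h₁⟩, ⟨y / z ^ (i + 1), h₂⟩], ![i], ⟨U₂, hU₂mem⟩, hU₂unit, ?_, hB''dim,
    Nat.one_pos, ?_, ?_⟩
  · rw [hmax'']
    congr 1
    ext v
    simp only [Set.mem_range, Set.mem_insert_iff, Set.mem_singleton_iff]
    constructor
    · rintro ⟨j, rfl⟩; fin_cases j <;> simp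
    · rintro (rfl | rfl | rfl); exacts [⟨1, rfl⟩, ⟨2, rfl⟩, ⟨0, rfl⟩]
  · intro j; fin_cases j; exact hi
  · rw [hsum, hkey, Fin.prod_univ_one]
    rfl

end Summit.ResolutionOfSingularities.ResolutionOfSingularities.Theorems.RadicialJung.CleanModels.Ccurve

end
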